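import Summits.BirchSwinnertonDyer.BirchSwinnertonDyer.Theses.ResidualThetaTransportAtTwo
import Summits.BirchSwinnertonDyer.BirchSwinnertonDyer.Theorems.ThetaPartnerAtTwoSignedControlAtTwoSignedEulerCharCount
import Summits.BirchSwinnertonDyer.BirchSwinnertonDyer.Theorems.ThetaPartnerAtTwoSignedControlAtTwoPlusLocalInjOfHonda
import Summits.BirchSwinnertonDyer.BirchSwinnertonDyer.Theorems.ThetaPartnerAtTwoSignedControlAtTwoLocalNonDivTwo
import Summits.BirchSwinnertonDyer.BirchSwinnertonDyer.Theorems.ResidualThetaTransportAtTwoSignedMuVanishingAtTwoPlusSel2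
import Summits.BirchSwinnertonDyer.BirchSwinnertonDyer.Theorems.ResidualThetaTransportAtTwoSignedMuVanishingAtTwoPlusLineV42
import Literature.NumberTheory.EllipticCurves.Kobayashi2003.SignedSelmerDualExistsProofs
import Literature.NumberTheory.EllipticCurves.Kobayashi2003.SignedSelmerModuleFiniteProofs
import HarnessLib

/-!
# Route `ResidualThetaTransportAtTwo`, crux Kμ⁺ `SignedMuVanishingAtTwoPlus` (stmt-BirchSwinnertonDyer-20689):
# the KURIHARA ROAD to the algebraic half — a SELMER-TRIVIAL member of the residual class seeds `μ = 0`

Cell `bsd-wall`, width seat `bsd-wall-rtt-p4-w3` (g2) on the lead line `birth` v4.2 (stubs `stub_residualSeedAtTwo` =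
ledger child 21438 `SignedMuSeedAtTwoPlus` BY NAME, `stub_periodUnitAtTwo` [print, Abbes–Ullmo], `stub_flatMuZeroAtTwo`
[research]). THEOREMS ONLY (no `def`, no named fact, no `sorry`); helper `--supports` the crux; every input is a landed
theorem consumed BY NAME; nothing about any particular curve is asserted; BSD is not proved by this.

WHAT. The two roads to the algebraic conjunct of Kμ⁺ recorded so far are (GV) the conjecture-grade seed 21438
(Greenberg's `μ = 0` for ONE good-supersingular `a₂ = 0` member of each residual class `W[2]`, then the PROVED
propagation 22891) and (Kato) KATO-INT@2 (route item K3 with exponent `m = 0`, w3 p581306). This file records a THIRD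
road, Kurihara's condition (∗) read at `2` — «`#Sel_{p^∞}(A/ℚ) = 1` and `p ∤ ∏ c_ℓ(A)`» — which is a FINITE, per-class
`2`-DESCENT CERTIFICATE on one congruent curve, and which needs from the signed theory at `2` exactly the local input
INJ⁺@2 of the shared crux K4 `SignedControlAtTwo` (line `eulerchar`: INJ⁺@2 ⟸ HONDA⁺@2, tp2-p3's research residue):

* §1 (generic, any number field, prime, sign). `signedSelmerInfty_eq_bot_of_forall_mem_endInvariants` — if the
  `γ`-invariants `Sel^ε(E/K_∞)^γ` vanish then `Sel^ε(E/K_∞) = 0`: `γ − 1` is locally nilpotent on the `p`-primary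
  group `Sel^ε_∞` (`isLocNil_conjSignedSelmerInfty_sub_one`), so a non-zero class has a non-zero iterate in the kernel.
* §2 (`K = ℚ`, cyclotomic `κ`, ANY `p`, either sign). `signedSelmerInfty_eq_bot_of_localInj_of_card_selmer_eq_one` —
  **INJ^ε@p at `(E, κ)` ∧ `#Sel_{p^∞}(E/ℚ) = 1` ∧ `p ∤ ∏ c_ℓ` ⟹ `Sel^ε(E/ℚ_∞) = 0`**, from tp2-p3's one-sided count
  `#(Sel^ε_∞)^γ · #E[p^∞](ℚ) ∣ #Sel_{p^∞}(E/ℚ) · p^{ord_p ∏ c_ℓ}` (`SignedEC.natCard_signedSelmerInvariants_mul_dvd_of_localInj`,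
  Greenberg's Lemma 3.2 / p. 88 count, no Poitou–Tate) and §1; hence
  `isTorsion_and_mu_eq_zero_of_localInj_of_card_selmer_eq_one`: **every signed Selmer dual datum is `Λ`-torsion with
  `μ = 0`** (indeed `X^ε = 0`; w2's `isTorsion_and_mu_eq_zero_iff_finite_selmer_pTorsion`). This is Kurihara's
  Theorem 0.1 shape / Kobayashi's "trivial case" at an arbitrary prime, with the `±` local control DISPLAYED as the
  hypothesis INJ^ε (B. D. Kim, proof of Cor. 3.15: «`g_v` is injective because `E(F_v) ⊗ ℚ_p/ℤ_p = (∏ H^±_w)^Γ`»).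
  At `p = 2`, `ε = +1` the hypothesis is K4's INJ⁺@2; for `ε = −1` at `2` it is not expected (Kurihara–Otsuki 2006
  Rem. 0.2 (3): `T + 2 ∣ g(T)` for `X₀(19)`-type curves).
* §3 (`p = 2`). `plusLocalInj_two_of_hondaData` — INJ⁺@2 at `(A, κ)` from HONDA⁺-data at `A` ALONE (tp2-p3's
  `SignedEC.plusLocalInj_two_of_honda`, its LEV0@2 input discharged for every elliptic curve by
  `SignedEC.exists_mem_localLayerPointsOfEmb_zero_ne_two_nsmul`); `isTorsion_and_mu_eq_zero_two_of_hondaData_of_card_selmer_eq_one`.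
* §4 (the crux). `signedMuSeedAtTwoPlus_of_selmerTrivialMember` — **the seed child 21438 BY NAME ⟸ «every habitat⁺ class
  `W[2]` contains a good-supersingular `a₂ = 0` curve `A` with INJ⁺@2 at every cyclotomic `κ`, `#Sel_{2^∞}(A/ℚ) = 1` and
  `2 ∤ ∏ c_ℓ(A)`»**; `…_of_hondaMember` (INJ⁺ ⟸ HONDA⁺-data at `A`); the algebraic conjunct of Kμ⁺ VERBATIM
  (`muAlgebraic_of_selmerTrivialMember`, through the proved propagation 22891 = g3's `muAlgebraic_iff_signedMuSeedAtTwoPlus`);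
  and the CRUX BY NAME from {Selmer-trivial member, child 21437} / {HONDA⁺ member, PER, FLAT}
  (`signedMuVanishingAtTwoPlus_of_analytic_of_selmerTrivialMember`, `…_of_hondaMember_of_periodUnit_of_flatMuZero`).

READING for the pen. Granted K4's local residue at `2` (HONDA⁺@2 ⟹ INJ⁺@2, needed by the Assembly anyway), the
conjecture-grade node 21438 «signed `μ = 0` for one member per class, no certificate» is replaced on every class where it can
be found by a CERTIFICATE: one congruent good-supersingular `a₂ = 0` curve with trivial `2^∞`-Selmer group and odd
Tamagawa product (a `2`-descent; e.g. `X₀(19)`: `L/Ω = 1/3`-type rows certify their own class; on D-rtt-1's 19 target rows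
`L(W,1)/Ω_W` is even, so there `A ≠ W` must be searched in the `W[2]`-family). Class-wide existence of such a member is
NOT claimed.

References: M. Kurihara, Invent. Math. 149 (2002) Thm. 0.1 [Kurihara2002]; M. Kurihara, R. Otsuki, Pure Appl. Math. Q.
2 (2006) 557–568, Thm. 0.1 and Rem. 0.2 (3) [KuriharaOtsuki2006]; S. Kobayashi, Invent. Math. 152 (2003) Def. 1.1,
Thm. 1.2, Thm. 9.3 [Kobayashi2003]; B. D. Kim, J. Aust. Math. Soc. 95 (2013) Cor. 3.15 [BDKim2013]; R. Greenberg,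
LNM 1716 (1999) §3 Lemma 3.2, §4 Lemmas 4.3–4.4 [GreenbergLNM1716]; R. Greenberg, V. Vatsal, Invent. Math. 142 (2000)
Prop. (2.8) [GreenbergVatsal2000].
-/

set_option autoImplicit false
set_option linter.dupNamespace false

noncomputable section

open scoped Classical NumberField MatrixGroups ModularForm

open NumberField IsDedekindDomain CongruenceSubgroup WeierstrassCurve
  Literature.NumberTheory.EllipticCurves Literature.NumberTheory.GaloisRepresentations
  Literature.NumberTheory.EllipticCurves.ModularForms Literature.NumberTheory.EllipticCurves.IwasawaAlgebra
  Literature.NumberTheory.EllipticCurves.IwasawaDual Literature.NumberTheory.EllipticCurves.Kobayashi2003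
  Literature.NumberTheory.EllipticCurves.Rank1Residual Literature.NumberTheory.EllipticCurves.ZpExtension
  Summit.BirchSwinnertonDyer.Rank1Residual.Supersingular Summit.BirchSwinnertonDyer.Rank1Residual.X1
  Summit.BirchSwinnertonDyer.BirchSwinnertonDyer.Theses.ResidualThetaTransportAtTwo

universe u

namespace Summit.BirchSwinnertonDyer.BirchSwinnertonDyer.Theorems.SelmerTrivialSeedAtTwo

/-! ## §1. Generic: vanishing `γ`-invariants force a signed Selmer group to vanish -/

/-- **A locally nilpotent endomorphism with trivial kernel acts on the zero group.** If every `s` is killed by some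
power of `ψ` and `ψ s = 0 ⇒ s = 0`, then `s = 0` for all `s` (induction on the killing exponent). [folklore] -/
theorem eq_zero_of_locNil_of_ker_trivial {S : Type*} [AddCommGroup S] {ψ : AddMonoid.End S}
    (hnil : ∀ s : S, ∃ N : ℕ, (ψ ^ N) s = 0) (hker : ∀ s : S, ψ s = 0 → s = 0) (s : S) : s = 0 := by
  obtain ⟨N, hN⟩ := hnil s
  induction N generalizing s with
  | zero => simpa using hN
  | succ N ih =>
    apply ih
    · exact hker _ (by rw [pow_succ'] at hN; exact hN)

/-- **`Sel^ε(E/K_∞)^γ = 0 ⟹ Sel^ε(E/K_∞) = 0`** (any number field `K`, prime `p`, `ℤ_p`-extension `κ`, topological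
generator `γ`, sign `ε`): `γ − 1` is locally nilpotent on the `p`-primary group `Sel^ε(E/K_∞)`
(`isLocNil_conjSignedSelmerInfty_sub_one`), so §1 applies — the discrete form of Nakayama's lemma `X/TX = 0 ⇒ X = 0`.
[cite: GreenbergLNM1716, §1 p. 60 (after Conj. 1.3)] [cite: Kobayashi2003, Def. 1.1] -/
theorem signedSelmerInfty_eq_bot_of_forall_mem_endInvariants {K : Type u} [Field K] [NumberField K]
    (W : WeierstrassCurve K) [W.IsElliptic] {p : ℕ} [Fact p.Prime] (κ : ZpExtension K p) (ε : ℤˣ)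
    {γ : Field.absoluteGaloisGroup K} (hγ : κ.IsTopGenerator γ)
    (h : ∀ s : signedSelmerInfty W κ ε, s ∈ endInvariants (conjSignedSelmerInfty W κ ε γ - 1) → s = 0) :
    signedSelmerInfty W κ ε = ⊥ := by
  rw [AddSubgroup.eq_bot_iff_forall]
  intro x hx
  have key : (⟨x, hx⟩ : signedSelmerInfty W κ ε) = 0 :=
    eq_zero_of_locNil_of_ker_trivial (isLocNil_conjSignedSelmerInfty_sub_one W κ ε hγ).nil
      (fun s hs ↦ h s ((mem_endInvariants_iff _ s).mpr hs)) _
  exact congrArg Subtype.val key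

/-- `#Sel^ε(E/K_∞)^γ = 1 ⟹ Sel^ε(E/K_∞) = 0` (the invariants subgroup is trivial, then the previous theorem).
[cite: GreenbergLNM1716, §1 p. 60 (after Conj. 1.3)] -/
theorem signedSelmerInfty_eq_bot_of_natCard_endInvariants_eq_one {K : Type u} [Field K] [NumberField K]
    (W : WeierstrassCurve K) [W.IsElliptic] {p : ℕ} [Fact p.Prime] (κ : ZpExtension K p) (ε : ℤˣ)
    {γ : Field.absoluteGaloisGroup K} (hγ : κ.IsTopGenerator γ)
    (h1 : Nat.card (endInvariants (conjSignedSelmerInfty W κ ε γ - 1)) = 1) :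
    signedSelmerInfty W κ ε = ⊥ := by
  have hbot := AddSubgroup.eq_bot_of_card_eq _ h1
  exact signedSelmerInfty_eq_bot_of_forall_mem_endInvariants W κ ε hγ
    fun s hs ↦ (AddSubgroup.eq_bot_iff_forall _).mp hbot s hs

/-- If `Sel^ε(E/K_∞) = 0` then every signed Selmer dual datum with `X` finitely generated is `Λ`-torsion with `μ = 0`
(`Sel^ε_∞[p]` is finite, indeed empty of non-zero classes; w2's `isTorsion_and_mu_eq_zero_iff_finite_selmer_pTorsion`).
[cite: GreenbergVatsal2000, p. 3 (proof of Thm. (1.4))] -/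
theorem isTorsion_and_mu_eq_zero_of_signedSelmerInfty_eq_bot {K : Type u} [Field K] [NumberField K]
    {W : WeierstrassCurve K} {p : ℕ} [Fact p.Prime] {κ : ZpExtension K p} {ε : ℤˣ}
    {γ : Field.absoluteGaloisGroup K} (hbot : signedSelmerInfty W κ ε = ⊥)
    (D : SignedSelmerDualData W κ γ ε) [Module.Finite (IwasawaAlgebra p) D.X] :
    Module.IsTorsion (IwasawaAlgebra p) D.X ∧ D.mu = 0 := by
  refine (SignedMuAtTwo.isTorsion_and_mu_eq_zero_iff_finite_selmer_pTorsion D).mpr ?_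
  haveI : Subsingleton (signedSelmerInfty W κ ε) :=
    ⟨fun a b ↦ Subtype.ext (((AddSubgroup.eq_bot_iff_forall _).mp hbot a a.2).trans
      ((AddSubgroup.eq_bot_iff_forall _).mp hbot b b.2).symm)⟩
  exact Set.toFinite _

/-! ## §2. `K = ℚ`, cyclotomic `κ`, any `p`, either sign: Kurihara's condition (∗) kills `Sel^ε(E/ℚ_∞)` under INJ^ε -/

/-- **Kurihara's condition (∗) at an arbitrary prime, signed form.** For `E/ℚ` elliptic, the cyclotomic `ℤ_p`-extension
`κ` with topological generator `γ`, a sign `ε`: IF (INJ^ε@p) every class of `h_0⁻¹(Sel^ε(E/ℚ_∞)) ⊆ H¹(ℚ, E[p^∞])` satisfies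
the classical local condition at the place above `p`, AND `#Sel_{p^∞}(E/ℚ) = 1`, AND `p ∤ ∏_ℓ c_ℓ`, THEN
**`Sel^ε(E/ℚ_∞) = 0`**. Proof: tp2-p3's one-sided count gives `#(Sel^ε_∞)^γ · #E[p^∞](ℚ) ∣ 1 · p⁰`, so `(Sel^ε_∞)^γ = 0`,
and §1. (Kurihara 2002 Thm. 0.1 / Kurihara–Otsuki 2006 Thm. 0.1 shape: there for the classical Selmer group at
`a_p = ±2`; B. D. Kim Cor. 3.15 proof for the `±` control input.) [cite: Kurihara2002, Thm. 0.1]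
[cite: KuriharaOtsuki2006, Thm. 0.1 and Rem. 0.2 (3)] [cite: BDKim2013, proof of Cor. 3.15 (pp. 199–200)]
[cite: GreenbergLNM1716, §3 Lemma 3.2, §4 Lemmas 4.3–4.4] -/
theorem signedSelmerInfty_eq_bot_of_localInj_of_card_selmer_eq_one (W : WeierstrassCurve ℚ) [W.IsElliptic]
    (p : ℕ) [Fact p.Prime] (ε : ℤˣ) {κ : ZpExtension ℚ p} (hκ : κ.IsCyclotomic)
    {γ : Field.absoluteGaloisGroup ℚ} (hγ : κ.IsTopGenerator γ)
    (hinj : ∀ v : HeightOneSpectrum (𝓞 ℚ), (p : 𝓞 ℚ) ∈ v.asIdeal →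
      ∀ y ∈ (signedSelmerInfty W κ ε).comap (W.layerToInfty κ 0),
        W.localResOver p (κ.layerSubgroup 0) (v.adicCompletion ℚ) y = 0)
    (hSel : Nat.card (W.selmerGroupPInfty p) = 1) (hTam : ¬ p ∣ W.tamagawaProduct) :
    signedSelmerInfty W κ ε = ⊥ := by
  have hfin : Finite (W.selmerGroupPInfty p) := Nat.finite_of_card_ne_zero (by rw [hSel]; exact one_ne_zero)
  obtain ⟨-, hdvd⟩ := SignedEC.natCard_signedSelmerInvariants_mul_dvd_of_localInj W p ε hκ hγ hinj hfin
  rw [hSel, padicValNat.eq_zero_of_not_dvd hTam, pow_zero, mul_one] at hdvd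
  exact signedSelmerInfty_eq_bot_of_natCard_endInvariants_eq_one W κ ε hγ
    (Nat.eq_one_of_dvd_one (dvd_of_mul_right_dvd hdvd))

/-- **Kurihara's condition (∗), dual form: every signed Selmer dual datum is `Λ`-torsion with `μ = 0`** (indeed `X^ε = 0`)
under INJ^ε@p, `#Sel_{p^∞}(E/ℚ) = 1`, `p ∤ ∏ c_ℓ` — for every datum with `X` finitely generated.
[cite: Kurihara2002, Thm. 0.1] [cite: BDKim2013, proof of Cor. 3.15 (pp. 199–200)] [cite: Kobayashi2003, Thm. 1.2] -/
theorem isTorsion_and_mu_eq_zero_of_localInj_of_card_selmer_eq_one (W : WeierstrassCurve ℚ) [W.IsElliptic]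
    (p : ℕ) [Fact p.Prime] (ε : ℤˣ) {κ : ZpExtension ℚ p} (hκ : κ.IsCyclotomic)
    {γ : Field.absoluteGaloisGroup ℚ} (hγ : κ.IsTopGenerator γ)
    (hinj : ∀ v : HeightOneSpectrum (𝓞 ℚ), (p : 𝓞 ℚ) ∈ v.asIdeal →
      ∀ y ∈ (signedSelmerInfty W κ ε).comap (W.layerToInfty κ 0),
        W.localResOver p (κ.layerSubgroup 0) (v.adicCompletion ℚ) y = 0)
    (hSel : Nat.card (W.selmerGroupPInfty p) = 1) (hTam : ¬ p ∣ W.tamagawaProduct)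
    (D : SignedSelmerDualData W κ γ ε) [Module.Finite (IwasawaAlgebra p) D.X] :
    Module.IsTorsion (IwasawaAlgebra p) D.X ∧ D.mu = 0 :=
  isTorsion_and_mu_eq_zero_of_signedSelmerInfty_eq_bot
    (signedSelmerInfty_eq_bot_of_localInj_of_card_selmer_eq_one W p ε hκ hγ hinj hSel hTam) D

/-- The same for EVERY datum, the finite-generation proviso discharged (`SignedSelmerDualData.moduleFinite`, Greenberg's
Nakayama argument, any prime). [cite: Kobayashi2003, Thm. 1.2 (the finite-generation clause)] [cite: Kurihara2002, Thm. 0.1] -/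
theorem isTorsion_and_mu_eq_zero_of_localInj_of_card_selmer_eq_one' (W : WeierstrassCurve ℚ) [W.IsElliptic]
    (p : ℕ) [Fact p.Prime] (ε : ℤˣ) {κ : ZpExtension ℚ p} (hκ : κ.IsCyclotomic)
    {γ : Field.absoluteGaloisGroup ℚ} (hγ : κ.IsTopGenerator γ)
    (hinj : ∀ v : HeightOneSpectrum (𝓞 ℚ), (p : 𝓞 ℚ) ∈ v.asIdeal →
      ∀ y ∈ (signedSelmerInfty W κ ε).comap (W.layerToInfty κ 0),
        W.localResOver p (κ.layerSubgroup 0) (v.adicCompletion ℚ) y = 0)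
    (hSel : Nat.card (W.selmerGroupPInfty p) = 1) (hTam : ¬ p ∣ W.tamagawaProduct)
    (D : SignedSelmerDualData W κ γ ε) :
    (haveI := D.moduleFinite hγ; Module.IsTorsion (IwasawaAlgebra p) D.X) ∧ D.mu = 0 := by
  haveI := D.moduleFinite hγ
  exact isTorsion_and_mu_eq_zero_of_localInj_of_card_selmer_eq_one W p ε hκ hγ hinj hSel hTam D

/-! ## §3. `p = 2`, sign `+`: INJ⁺@2 from HONDA⁺-data at the curve alone (tp2-p3's reductions BY NAME) -/

/-- **INJ⁺@2 at `(A, κ)` from HONDA⁺-data at `A`.** For `A/ℚ` globally minimal, good supersingular at `2`, the cyclotomic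
`ℤ₂`-extension `κ` and the place `v ∋ 2`: a Honda-type system `d : ℕ → E(ℚ̄_v)` of local points (`d_m ∈ E(ℚ_{m,v})`,
`Tr_{m+2/m+1} d_{m+2} = −d_m`, generation at the layers `m ≥ 1` and at `m = 0` modulo `2`) gives the classical local
condition at `2` for every class of `h_0⁻¹(Sel⁺(A/ℚ_∞))` — tp2-p3's `SignedEC.plusLocalInj_two_of_honda`, with its LEV0@2
input discharged for every elliptic curve (`SignedEC.exists_mem_localLayerPointsOfEmb_zero_ne_two_nsmul`, Milne I 3.3).
[cite: Kobayashi2003, §8 Prop. 8.12, Thm. 9.3] [cite: BDKim2013, proof of Cor. 3.15 (pp. 199–200)] [cite: MilneADT2006, I Lemma 3.3] -/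
theorem plusLocalInj_two_of_hondaData (A : WeierstrassCurve ℚ) [A.IsElliptic] [A.IsGloballyMinimal]
    (hss : GoodSS A 2) {κ : ZpExtension ℚ 2} (hκ : κ.IsCyclotomic) (v : HeightOneSpectrum (𝓞 ℚ))
    (hv : (2 : 𝓞 ℚ) ∈ v.asIdeal)
    (hH : ∃ d : ℕ → localPoints A (v.adicCompletion ℚ),
      (∀ m, d m ∈ localLayerPointsOfEmb κ (closureEmb (K := ℚ) (v.adicCompletion ℚ)) A m) ∧
      (∀ m, localTraceOfEmb κ (closureEmb (K := ℚ) (v.adicCompletion ℚ)) A (m + 1) (m + 2) (d (m + 2)) = -d m) ∧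
      (∀ m : ℕ, 1 ≤ m → ∀ P ∈ localLayerPointsOfEmb κ (closureEmb (K := ℚ) (v.adicCompletion ℚ)) A m,
        ∃ B ∈ AddSubgroup.closure (Set.range fun σ : Field.absoluteGaloisGroup (v.adicCompletion ℚ) ↦ σ • d m),
          ∃ P' ∈ localLayerPointsOfEmb κ (closureEmb (K := ℚ) (v.adicCompletion ℚ)) A (m - 1),
          ∃ R ∈ localLayerPointsOfEmb κ (closureEmb (K := ℚ) (v.adicCompletion ℚ)) A m, P = B + P' + 2 • R) ∧
      (∀ P ∈ localLayerPointsOfEmb κ (closureEmb (K := ℚ) (v.adicCompletion ℚ)) A 0,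
        ∃ a : ℤ, ∃ R ∈ localLayerPointsOfEmb κ (closureEmb (K := ℚ) (v.adicCompletion ℚ)) A 0, P = a • d 0 + 2 • R)) :
    ∀ y ∈ (signedSelmerInfty A κ 1).comap (A.layerToInfty κ 0),
      A.localResOver 2 (κ.layerSubgroup 0) (v.adicCompletion ℚ) y = 0 := by
  obtain ⟨d, hd, htr, hgen, hgen0⟩ := hH
  exact SignedEC.plusLocalInj_two_of_honda A hss hκ v hv
    (SignedEC.exists_mem_localLayerPointsOfEmb_zero_ne_two_nsmul A κ v hv) d hd htr hgen hgen0

/-- **`p = 2`: a HONDA⁺ curve with trivial `2^∞`-Selmer group and odd Tamagawa product has `Sel⁺(A/ℚ_∞) = 0`**, hence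
all its `+` signed Selmer dual data are `Λ`-torsion with `μ = 0` (§2 + §3). [cite: KuriharaOtsuki2006, Thm. 0.1 and Rem. 0.2 (3)]
[cite: Kobayashi2003, Thm. 1.2, Thm. 9.3] [cite: BDKim2013, Cor. 3.15] -/
theorem signedSelmerInfty_eq_bot_two_of_hondaData_of_card_selmer_eq_one (A : WeierstrassCurve ℚ) [A.IsElliptic]
    [A.IsGloballyMinimal] (hss : GoodSS A 2) {κ : ZpExtension ℚ 2} (hκ : κ.IsCyclotomic)
    {γ : Field.absoluteGaloisGroup ℚ} (hγ : κ.IsTopGenerator γ)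
    (hH : ∀ (v : HeightOneSpectrum (𝓞 ℚ)), (2 : 𝓞 ℚ) ∈ v.asIdeal →
      ∃ d : ℕ → localPoints A (v.adicCompletion ℚ),
      (∀ m, d m ∈ localLayerPointsOfEmb κ (closureEmb (K := ℚ) (v.adicCompletion ℚ)) A m) ∧
      (∀ m, localTraceOfEmb κ (closureEmb (K := ℚ) (v.adicCompletion ℚ)) A (m + 1) (m + 2) (d (m + 2)) = -d m) ∧
      (∀ m : ℕ, 1 ≤ m → ∀ P ∈ localLayerPointsOfEmb κ (closureEmb (K := ℚ) (v.adicCompletion ℚ)) A m,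
        ∃ B ∈ AddSubgroup.closure (Set.range fun σ : Field.absoluteGaloisGroup (v.adicCompletion ℚ) ↦ σ • d m),
          ∃ P' ∈ localLayerPointsOfEmb κ (closureEmb (K := ℚ) (v.adicCompletion ℚ)) A (m - 1),
          ∃ R ∈ localLayerPointsOfEmb κ (closureEmb (K := ℚ) (v.adicCompletion ℚ)) A m, P = B + P' + 2 • R) ∧
      (∀ P ∈ localLayerPointsOfEmb κ (closureEmb (K := ℚ) (v.adicCompletion ℚ)) A 0,
        ∃ a : ℤ, ∃ R ∈ localLayerPointsOfEmb κ (closureEmb (K := ℚ) (v.adicCompletion ℚ)) A 0, P = a • d 0 + 2 • R))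
    (hSel : Nat.card (A.selmerGroupPInfty 2) = 1) (hTam : ¬ 2 ∣ A.tamagawaProduct) :
    signedSelmerInfty A κ 1 = ⊥ :=
  signedSelmerInfty_eq_bot_of_localInj_of_card_selmer_eq_one A 2 1 hκ hγ
    (fun v hv ↦ plusLocalInj_two_of_hondaData A hss hκ v hv (hH v hv)) hSel hTam

/-! ## §4. The seed child 21438, the algebraic conjunct of Kμ⁺, and the crux BY NAME -/

/-- **The seed child 21438 `SignedMuSeedAtTwoPlus` BY NAME from a SELMER-TRIVIAL MEMBER of each residual class**: if every
habitat⁺ curve `W` is congruent mod `2` (`W[2] ≃ A[2]` equivariantly) to a globally minimal, good-supersingular, `a₂ = 0`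
curve `A/ℚ` such that (INJ⁺@2) at every cyclotomic `ℤ₂`-extension the classes of `h_0⁻¹(Sel⁺(A/ℚ_∞))` satisfy the
classical local condition at `2`, `#Sel_{2^∞}(A/ℚ) = 1` and `2 ∤ ∏ c_ℓ(A)`, then the seed child holds (`A`'s `+` signed Selmer
group over `ℚ_∞` VANISHES). [cite: Kurihara2002, Thm. 0.1] [cite: KuriharaOtsuki2006, Rem. 0.2 (3)]
[cite: GreenbergVatsal2000, p. 3 and Prop. (2.8)] -/
theorem signedMuSeedAtTwoPlus_of_selmerTrivialMember
    (hmem : ∀ (W : WeierstrassCurve ℚ) [W.IsElliptic] [W.IsGloballyMinimal], ¬ W.HasCM → W.analyticRank = 0 →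
      GoodSS W 2 → W.frobeniusTrace 2 = 0 → W.Δ < 0 →
      ∃ (A : WeierstrassCurve ℚ) (_ : A.IsElliptic) (_ : A.IsGloballyMinimal), GoodSS A 2 ∧ A.frobeniusTrace 2 = 0 ∧
        (∃ e : WeierstrassCurve.geomTorsion W (2 : ℤ) ≃+ WeierstrassCurve.geomTorsion A (2 : ℤ),
          ∀ (σ : Field.absoluteGaloisGroup ℚ) (P : WeierstrassCurve.geomTorsion W (2 : ℤ)), e (σ • P) = σ • e P) ∧
        (∀ (κ : ZpExtension ℚ 2), κ.IsCyclotomic →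
          ∀ v : HeightOneSpectrum (𝓞 ℚ), (2 : 𝓞 ℚ) ∈ v.asIdeal →
          ∀ y ∈ (signedSelmerInfty A κ 1).comap (A.layerToInfty κ 0),
            A.localResOver 2 (κ.layerSubgroup 0) (v.adicCompletion ℚ) y = 0) ∧
        Nat.card (A.selmerGroupPInfty 2) = 1 ∧ ¬ 2 ∣ A.tamagawaProduct) :
    SignedMuSeedAtTwoPlus := by
  refine SignedMuAtTwo.signedMuSeedAtTwoPlus_of_sel2Seed fun W _ _ hCM hr hss ha hΔ ↦ ?_
  obtain ⟨A, hAell, hAmin, hssA, haA, hiso, hinj, hSel, hTam⟩ := hmem W hCM hr hss ha hΔ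
  refine ⟨A, hAell, hAmin, hssA, haA, hiso, fun κ γ hκ hγ _ ↦ ?_⟩
  have hbot := signedSelmerInfty_eq_bot_of_localInj_of_card_selmer_eq_one A 2 1 hκ hγ (hinj κ hκ) hSel hTam
  haveI : Subsingleton (signedSelmerInfty A κ 1) :=
    ⟨fun a b ↦ Subtype.ext (((AddSubgroup.eq_bot_iff_forall _).mp hbot a a.2).trans
      ((AddSubgroup.eq_bot_iff_forall _).mp hbot b b.2).symm)⟩
  exact Set.toFinite _

/-- **The seed child 21438 BY NAME from a HONDA⁺ Selmer-trivial member of each class**: as above with INJ⁺@2 replaced by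
HONDA⁺-data at `A` (K4's research residue `stub_plusHondaSystemTwo` of line `eulerchar`, stated for the one curve `A`).
[cite: Kobayashi2003, §8 Prop. 8.12, Thm. 9.3] [cite: KuriharaOtsuki2006, Thm. 0.1 and Rem. 0.2 (3)] -/
theorem signedMuSeedAtTwoPlus_of_hondaMember
    (hmem : ∀ (W : WeierstrassCurve ℚ) [W.IsElliptic] [W.IsGloballyMinimal], ¬ W.HasCM → W.analyticRank = 0 →
      GoodSS W 2 → W.frobeniusTrace 2 = 0 → W.Δ < 0 →
      ∃ (A : WeierstrassCurve ℚ) (_ : A.IsElliptic) (_ : A.IsGloballyMinimal), GoodSS A 2 ∧ A.frobeniusTrace 2 = 0 ∧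
        (∃ e : WeierstrassCurve.geomTorsion W (2 : ℤ) ≃+ WeierstrassCurve.geomTorsion A (2 : ℤ),
          ∀ (σ : Field.absoluteGaloisGroup ℚ) (P : WeierstrassCurve.geomTorsion W (2 : ℤ)), e (σ • P) = σ • e P) ∧
        (∀ (κ : ZpExtension ℚ 2), κ.IsCyclotomic →
          ∀ (v : HeightOneSpectrum (𝓞 ℚ)), (2 : 𝓞 ℚ) ∈ v.asIdeal →
          ∃ d : ℕ → localPoints A (v.adicCompletion ℚ),
          (∀ m, d m ∈ localLayerPointsOfEmb κ (closureEmb (K := ℚ) (v.adicCompletion ℚ)) A m) ∧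
          (∀ m, localTraceOfEmb κ (closureEmb (K := ℚ) (v.adicCompletion ℚ)) A (m + 1) (m + 2) (d (m + 2)) = -d m) ∧
          (∀ m : ℕ, 1 ≤ m → ∀ P ∈ localLayerPointsOfEmb κ (closureEmb (K := ℚ) (v.adicCompletion ℚ)) A m,
            ∃ B ∈ AddSubgroup.closure (Set.range fun σ : Field.absoluteGaloisGroup (v.adicCompletion ℚ) ↦ σ • d m),
              ∃ P' ∈ localLayerPointsOfEmb κ (closureEmb (K := ℚ) (v.adicCompletion ℚ)) A (m - 1),
              ∃ R ∈ localLayerPointsOfEmb κ (closureEmb (K := ℚ) (v.adicCompletion ℚ)) A m, P = B + P' + 2 • R) ∧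
          (∀ P ∈ localLayerPointsOfEmb κ (closureEmb (K := ℚ) (v.adicCompletion ℚ)) A 0,
            ∃ a : ℤ, ∃ R ∈ localLayerPointsOfEmb κ (closureEmb (K := ℚ) (v.adicCompletion ℚ)) A 0,
              P = a • d 0 + 2 • R)) ∧
        Nat.card (A.selmerGroupPInfty 2) = 1 ∧ ¬ 2 ∣ A.tamagawaProduct) :
    SignedMuSeedAtTwoPlus := by
  refine signedMuSeedAtTwoPlus_of_selmerTrivialMember fun W _ _ hCM hr hss ha hΔ ↦ ?_
  obtain ⟨A, hAell, hAmin, hssA, haA, hiso, hH, hSel, hTam⟩ := hmem W hCM hr hss ha hΔ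
  exact ⟨A, hAell, hAmin, hssA, haA, hiso,
    fun κ hκ v hv ↦ plusLocalInj_two_of_hondaData A hssA hκ v hv (hH κ hκ v hv), hSel, hTam⟩

/-- **The algebraic conjunct of Kμ⁺ VERBATIM from a Selmer-trivial member of each class** — the seed of §4 composed with
the PROVED propagation 22891 along `W[2] ≃ A[2]` for `Δ_W < 0` (lead g3's `muAlgebraic_iff_signedMuSeedAtTwoPlus`, resting
on w3's Sel2-transfer p584569 and w2's p580570). [cite: GreenbergVatsal2000, Prop. (2.8)] [cite: BDKim2009, Cor. 2.13]
[cite: Kurihara2002, Thm. 0.1] -/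
theorem muAlgebraic_of_selmerTrivialMember
    (hmem : ∀ (W : WeierstrassCurve ℚ) [W.IsElliptic] [W.IsGloballyMinimal], ¬ W.HasCM → W.analyticRank = 0 →
      GoodSS W 2 → W.frobeniusTrace 2 = 0 → W.Δ < 0 →
      ∃ (A : WeierstrassCurve ℚ) (_ : A.IsElliptic) (_ : A.IsGloballyMinimal), GoodSS A 2 ∧ A.frobeniusTrace 2 = 0 ∧
        (∃ e : WeierstrassCurve.geomTorsion W (2 : ℤ) ≃+ WeierstrassCurve.geomTorsion A (2 : ℤ),
          ∀ (σ : Field.absoluteGaloisGroup ℚ) (P : WeierstrassCurve.geomTorsion W (2 : ℤ)), e (σ • P) = σ • e P) ∧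
        (∀ (κ : ZpExtension ℚ 2), κ.IsCyclotomic →
          ∀ v : HeightOneSpectrum (𝓞 ℚ), (2 : 𝓞 ℚ) ∈ v.asIdeal →
          ∀ y ∈ (signedSelmerInfty A κ 1).comap (A.layerToInfty κ 0),
            A.localResOver 2 (κ.layerSubgroup 0) (v.adicCompletion ℚ) y = 0) ∧
        Nat.card (A.selmerGroupPInfty 2) = 1 ∧ ¬ 2 ∣ A.tamagawaProduct) :
    ∀ (W : WeierstrassCurve ℚ) [W.IsElliptic] [W.IsGloballyMinimal], ¬ W.HasCM → W.analyticRank = 0 →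
      GoodSS W 2 → W.frobeniusTrace 2 = 0 → W.Δ < 0 →
      ∀ (κ : ZpExtension ℚ 2) (γ : Field.absoluteGaloisGroup ℚ), κ.IsCyclotomic → κ.IsTopGenerator γ →
      ∀ (D : SignedSelmerDualData W κ γ 1) [Module.Finite (IwasawaAlgebra 2) D.X],
        Module.IsTorsion (IwasawaAlgebra 2) D.X ∧ D.mu = 0 :=
  SignedMuAtTwo.muAlgebraic_iff_signedMuSeedAtTwoPlus.mpr (signedMuSeedAtTwoPlus_of_selmerTrivialMember hmem)

/-- **THE CRUX BY NAME from {Selmer-trivial member per class, the analytic child 21437}.** Conjunct 1 by the previous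
theorem, conjunct 2 = the child `SignedMuAnalyticAtTwoPlus` (g3's kernel-exact `signedMuVanishingAtTwoPlus_of_analytic_of_seed`).
[cite: Kurihara2002, Thm. 0.1] [cite: GreenbergVatsal2000, p. 2 (2) and Prop. (2.8)] [cite: Pollack2003, Prop. 6.18] -/
theorem signedMuVanishingAtTwoPlus_of_analytic_of_selmerTrivialMember (hAn : SignedMuAnalyticAtTwoPlus)
    (hmem : ∀ (W : WeierstrassCurve ℚ) [W.IsElliptic] [W.IsGloballyMinimal], ¬ W.HasCM → W.analyticRank = 0 →
      GoodSS W 2 → W.frobeniusTrace 2 = 0 → W.Δ < 0 →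
      ∃ (A : WeierstrassCurve ℚ) (_ : A.IsElliptic) (_ : A.IsGloballyMinimal), GoodSS A 2 ∧ A.frobeniusTrace 2 = 0 ∧
        (∃ e : WeierstrassCurve.geomTorsion W (2 : ℤ) ≃+ WeierstrassCurve.geomTorsion A (2 : ℤ),
          ∀ (σ : Field.absoluteGaloisGroup ℚ) (P : WeierstrassCurve.geomTorsion W (2 : ℤ)), e (σ • P) = σ • e P) ∧
        (∀ (κ : ZpExtension ℚ 2), κ.IsCyclotomic →
          ∀ v : HeightOneSpectrum (𝓞 ℚ), (2 : 𝓞 ℚ) ∈ v.asIdeal →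
          ∀ y ∈ (signedSelmerInfty A κ 1).comap (A.layerToInfty κ 0),
            A.localResOver 2 (κ.layerSubgroup 0) (v.adicCompletion ℚ) y = 0) ∧
        Nat.card (A.selmerGroupPInfty 2) = 1 ∧ ¬ 2 ∣ A.tamagawaProduct) :
    SignedMuVanishingAtTwoPlus :=
  SignedMuAtTwo.signedMuVanishingAtTwoPlus_of_analytic_of_seed hAn (signedMuSeedAtTwoPlus_of_selmerTrivialMember hmem)

/-- **THE CRUX BY NAME from {HONDA⁺ Selmer-trivial member per class, PER, FLAT}** — line `birth` v4.2 with its hardest stub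
`stub_residualSeedAtTwo` replaced by «K4's local residue at one congruent curve + a 2-descent certificate», the two analytic
stubs verbatim (g3's `signedMuVanishingAtTwoPlus_of_seed_of_periodUnit_of_flatMuZero`).
[cite: KuriharaOtsuki2006, Thm. 0.1 and Rem. 0.2 (3)] [cite: Kobayashi2003, §8 Prop. 8.12, Thm. 9.3]
[cite: Pollack2003, Prop. 6.18] [cite: AbbesUllmo1996, Thm. A] -/
theorem signedMuVanishingAtTwoPlus_of_hondaMember_of_periodUnit_of_flatMuZero
    (hmem : ∀ (W : WeierstrassCurve ℚ) [W.IsElliptic] [W.IsGloballyMinimal], ¬ W.HasCM → W.analyticRank = 0 →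
      GoodSS W 2 → W.frobeniusTrace 2 = 0 → W.Δ < 0 →
      ∃ (A : WeierstrassCurve ℚ) (_ : A.IsElliptic) (_ : A.IsGloballyMinimal), GoodSS A 2 ∧ A.frobeniusTrace 2 = 0 ∧
        (∃ e : WeierstrassCurve.geomTorsion W (2 : ℤ) ≃+ WeierstrassCurve.geomTorsion A (2 : ℤ),
          ∀ (σ : Field.absoluteGaloisGroup ℚ) (P : WeierstrassCurve.geomTorsion W (2 : ℤ)), e (σ • P) = σ • e P) ∧
        (∀ (κ : ZpExtension ℚ 2), κ.IsCyclotomic →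
          ∀ (v : HeightOneSpectrum (𝓞 ℚ)), (2 : 𝓞 ℚ) ∈ v.asIdeal →
          ∃ d : ℕ → localPoints A (v.adicCompletion ℚ),
          (∀ m, d m ∈ localLayerPointsOfEmb κ (closureEmb (K := ℚ) (v.adicCompletion ℚ)) A m) ∧
          (∀ m, localTraceOfEmb κ (closureEmb (K := ℚ) (v.adicCompletion ℚ)) A (m + 1) (m + 2) (d (m + 2)) = -d m) ∧
          (∀ m : ℕ, 1 ≤ m → ∀ P ∈ localLayerPointsOfEmb κ (closureEmb (K := ℚ) (v.adicCompletion ℚ)) A m,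
            ∃ B ∈ AddSubgroup.closure (Set.range fun σ : Field.absoluteGaloisGroup (v.adicCompletion ℚ) ↦ σ • d m),
              ∃ P' ∈ localLayerPointsOfEmb κ (closureEmb (K := ℚ) (v.adicCompletion ℚ)) A (m - 1),
              ∃ R ∈ localLayerPointsOfEmb κ (closureEmb (K := ℚ) (v.adicCompletion ℚ)) A m, P = B + P' + 2 • R) ∧
          (∀ P ∈ localLayerPointsOfEmb κ (closureEmb (K := ℚ) (v.adicCompletion ℚ)) A 0,
            ∃ a : ℤ, ∃ R ∈ localLayerPointsOfEmb κ (closureEmb (K := ℚ) (v.adicCompletion ℚ)) A 0,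
              P = a • d 0 + 2 • R)) ∧
        Nat.card (A.selmerGroupPInfty 2) = 1 ∧ ¬ 2 ∣ A.tamagawaProduct)
    (hper : ∀ (W : WeierstrassCurve ℚ) [W.IsElliptic] [W.IsGloballyMinimal], GoodSS W 2 →
      ∀ [NeZero (W.conductorNorm ℤ)] (f : CuspForm (Gamma0 (W.conductorNorm ℤ)) 2), IsNewformOf W f →
      ∃ u : ℚ, ‖(u : ℚ_[2])‖ = 1 ∧ W.realPeriodRat = u * plusPeriod f)
    (hflat : ∀ (W : WeierstrassCurve ℚ) [W.IsElliptic] [W.IsGloballyMinimal], ¬ W.HasCM →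
      W.analyticRank = 0 → GoodSS W 2 → W.frobeniusTrace 2 = 0 → W.Δ < 0 →
      ∀ [NeZero (W.conductorNorm ℤ)] (f : CuspForm (Gamma0 (W.conductorNorm ℤ)) 2), IsNewformOf W f →
      ∀ (Lplus Lminus : IwasawaAlgebra 2), IsPollackPair f 2 Lplus Lminus →
      ¬ PowerSeries.C (2 : ℤ_[2]) ∣ Lminus) :
    SignedMuVanishingAtTwoPlus :=
  SignedMuAtTwo.signedMuVanishingAtTwoPlus_of_seed_of_periodUnit_of_flatMuZero (signedMuSeedAtTwoPlus_of_hondaMember hmem)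
    hper hflat

/-- **The habitat curve AS ITS OWN certificate** (the `X₀(19)`-type rows with odd `L(W,1)/Ω_W`): a habitat⁺ curve `W` with
INJ⁺@2 at every cyclotomic `κ`, `#Sel_{2^∞}(W/ℚ) = 1` and `2 ∤ ∏ c_ℓ(W)` satisfies conjunct 1 of Kμ⁺ directly — `Sel⁺(W/ℚ_∞) = 0`,
no transport. [cite: Kurihara2002, Thm. 0.1] [cite: KuriharaOtsuki2006, Rem. 0.2 (3)] -/
theorem isTorsion_and_mu_eq_zero_two_of_localInj_of_card_selmer_eq_one (W : WeierstrassCurve ℚ) [W.IsElliptic]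
    (hinj : ∀ (κ : ZpExtension ℚ 2), κ.IsCyclotomic →
      ∀ v : HeightOneSpectrum (𝓞 ℚ), (2 : 𝓞 ℚ) ∈ v.asIdeal →
      ∀ y ∈ (signedSelmerInfty W κ 1).comap (W.layerToInfty κ 0),
        W.localResOver 2 (κ.layerSubgroup 0) (v.adicCompletion ℚ) y = 0)
    (hSel : Nat.card (W.selmerGroupPInfty 2) = 1) (hTam : ¬ 2 ∣ W.tamagawaProduct) :
    ∀ (κ : ZpExtension ℚ 2) (γ : Field.absoluteGaloisGroup ℚ), κ.IsCyclotomic → κ.IsTopGenerator γ →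
      ∀ (D : SignedSelmerDualData W κ γ 1) [Module.Finite (IwasawaAlgebra 2) D.X],
        Module.IsTorsion (IwasawaAlgebra 2) D.X ∧ D.mu = 0 :=
  fun κ _γ hκ hγ D _ ↦ isTorsion_and_mu_eq_zero_of_localInj_of_card_selmer_eq_one W 2 1 hκ hγ (hinj κ hκ) hSel hTam D

end Summit.BirchSwinnertonDyer.BirchSwinnertonDyer.Theorems.SelmerTrivialSeedAtTwo

end
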